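import Summits.CriticalPhenomena.PercolationContinuityZ3.Theorems.Transplant.SkelPhiForcedKitClause
import Summits.CriticalPhenomena.PercolationContinuityZ3.Theorems.Transplant.SkelPhiKitsAHab
import HarnessLib

/-!
# N2 (frames-only node `SamePDropOfSkeletonFrm₁`, OPEN), (S0) kit tier, Skel side (junction J8): **THE KIT CLAUSE OF A WINDOW LEVEL WITH THE FORCED KIT
# OVER A HABITAT WINDOW** (`Skelφ.kitClauseFHab`) — p1-g16's `kitClauseF` (SkelPhiForcedKitClause p339101, window graph `winGraph G w₀ R`) re-read in
# the HABITAT graph `winGraphIn G Ω` (`Ω ⊇ winLevel`, levels `winLevelIn ψ Ω lo hi j`, level data `winLDataIn`): the forced kit `forcedGeom` of the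
# plain window is PADDED over `Ω` by p1-g11's `habPad` (SkelPhiSeedKitHab: a padded contact — an `Ω`-contact that is not a plain contact of
# `(w₀, R)` — gets the one-vertex kit at its inner `Ω`-neighbour), exactly as N1's `kitClauseAHab` (SkelPhiKitsAHab, N-K7a) padded the apron kit.
WHY (located, lane INBOX 2026-08-22T21:45:11Z, J8): the (C) residue of record `Skel.ReachOblAtHNF` (C2-SPEC §2) binds its chain in
`winGraphIn G Ω`; every (S0) clause so far (`kitClauseF`, `kitClause_runXF/YF`, `hkits_runXF/YF`) is a plain-window clause.
builds on p205010 (kernel theorem, internal audit signed; external expert review pending) — nothing in this file uses p205010; nothing here is a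
claim about the open node `SamePDropOfSkeletonFrm₁`.
Lane `prim-bschramm`, seat `prim-bschramm-p5` (gen 15; (C) lineage) — DISCLOSURE: a kit-tier file typed by the (C) pen from p1's `kitClauseF` and
`kitClauseAHab` texts while p1-g16 is parked (lead 21:20:50Z); counter-signature by the p1 lineage requested (AUDIT-NEG1L precedent).
Helper file (`--supports stmt-CriticalPhenomena-4575 --as helper`).
INPUTS: `kitClauseF`'s rows verbatim; `hfull : winLevel ⊆ Ω`; `hXD : winLevelIn ⊆ D`; per `Ω`-contact: PADDED ⇒ its inner `Ω`-neighbour in the target;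
plain FAR ⇒ its inner neighbour in the target; plain NEAR ⇒ a zone-box vertex in the target or the route datum at accuracy `δ³`.
OUTPUT: the per-level bundle of `TStep.KitsAtF` for `winLDataIn G ψ Ω lo hi o Sfin`, pinning set `pinSetFHab` = the union of the padded kit's faces.
* `pinSetFHab`, `face_subset_pinSetFHab`, **`kitClauseFHab`**.
[cite: KozmaNitzan2024, §4 Lemma 10, Steps III–IV (pp. 19–21)] [cite: GrimmettPercolation1999, §7.2]
-/

noncomputable section

open scoped Classical

namespace Summit.CriticalPhenomena.PercolationContinuityZ3.Theorems.Transplant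

namespace Skelφ

open MeasureTheory
open Literature.Probability.Percolation Literature.Probability.LatticeModels SimpleGraph KNLevels
open Literature.Barriers.CriticalPhenomena (graphBall graphBall_finite mem_graphBall_self graphBall_mono)
open Skel (winGraph winGraph_adj winGraph_le winGraphIn KitGeom)
open SkelI (tanOff tanTgt tanTgt_mem kitSeed edgesIn_subset_kitSeed kitSeed_congr mem_kitSeed_pad)
open Literature.Probability.Percolation.KozmaNitzan.Cells (oth oth_ne eq_oth_of_ne oth_oth)

variable {V : Type} [DecidableEq V] {G : SimpleGraph V} [G.LocallyFinite] {ψ φ : V → Site 2}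

/-! ## §1 The shell of the padded forced kit -/

section Shell

variable (G) {lo hi : Site 2} {j : ℕ} (SF : ∀ (i : Fin 2) (σ : ℤˣ), SideForm ψ φ (lo - (j : Site 2)) (hi + (j : Site 2)) i σ) (P : ApronPrm)
  (Ω : Finset V) (w₀ : V) (R : ℕ) (Λc : V → ℕ → Finset V) (kz : ℕ)

/-- **The shell of the padded forced kit over the habitat**: the union over the `Ω`-contacts of the faces of `habPad (forcedGeom …)` (near: the zone
box about the kit centre; far: `{y}`; padded: the inner `Ω`-neighbour). [this work] -/
def pinSetFHab : Finset V :=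
  (outerBoundary (winGraphIn G Ω) (winLevelIn ψ Ω lo hi j)).biUnion fun x =>
    (habPad G ψ Ω w₀ R lo hi j (forcedGeom G SF P w₀ R Λc kz)).U x

variable {G SF P Ω w₀ R Λc kz}

/-- Every face of the padded forced kit lies in the shell. [folklore] -/
theorem face_subset_pinSetFHab {x : V} (hx : x ∈ outerBoundary (winGraphIn G Ω) (winLevelIn ψ Ω lo hi j)) :
    (habPad G ψ Ω w₀ R lo hi j (forcedGeom G SF P w₀ R Λc kz)).U x ⊆ pinSetFHab G SF P Ω w₀ R Λc kz :=
  Finset.subset_biUnion_of_mem (fun x => (habPad G ψ Ω w₀ R lo hi j (forcedGeom G SF P w₀ R Λc kz)).U x) hx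

end Shell

/-! ## §2 The kit clause over the habitat -/

/-- **THE KIT CLAUSE OF A WINDOW LEVEL WITH THE FORCED KIT, OVER A HABITAT WINDOW** (`Γ = winGraphIn G Ω`, levels `winLevelIn ψ Ω lo hi j`,
`Ω ⊇ winLevel`; the per-level clause of `TStep.KitsAtF` for `winLDataIn`): `kitClauseF`'s rows; per `Ω`-contact — PADDED: its inner `Ω`-neighbour in
the target; plain FAR: its inner neighbour in the target; plain NEAR: a zone-box vertex in the target or the route datum at accuracy `δ³`.
[cite: KozmaNitzan2024, §4 Lemma 10, Steps III–IV (pp. 19–21)] [this work] -/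
theorem kitClauseFHab [Countable V] {lo hi : Site 2} {j : ℕ} {w₀ : V} {R : ℕ}
    (SF : ∀ (i : Fin 2) (σ : ℤˣ), SideForm ψ φ (lo - (j : Site 2)) (hi + (j : Site 2)) i σ) (Rg : V → Finset V) {P : ApronPrm}
    {KCmax Rs rs cS cU Δ : ℕ}
    (hlip : Lip G ψ) (hq : QStepsN G ψ P.N) (hstep : Steps G φ) (hΔ : ∀ v, G.degree v ≤ Δ) {q : unitInterval} {δ : ℝ} (hδ : 0 < δ)
    -- the window level and the kit constants
    (hwide : ∀ i, (lo - (j : Site 2)) i + 2 * tanOff P.ℓs P.M ≤ (hi + (j : Site 2)) i)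
    (hdw : ∀ i, (lo - (j : Site 2)) i + (P.d + 2 : ℕ) ≤ (hi + (j : Site 2)) i)
    (hKC : ∀ (i : Fin 2) (σ : ℤˣ) (z : Site 2), (SF i σ).θ (1 + P.d) ≤ (SF i σ).lin z → (SF i σ).lin z < (SF i σ).θ (2 + P.d) →
      (SF i σ).kitK z (shellD P) P.A ≤ KCmax)
    (hA : 0 ≤ P.A) (hθA : ∀ (i : Fin 2) (σ : ℤˣ), (SF i σ).θ (2 + P.d) ≤ (SF i σ).θ (shellD P) + P.A)
    (hr₀ : P.N * (tanOff P.ℓs P.M + 2) + P.N * P.d + (KCmax + Rs) ≤ P.r₀) (hR : P.r₀ ≤ R)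
    (hT : (shellD P : ℤ) + KCmax + Rs ≤ tanOff P.ℓs P.M)
    (hDw : ∀ i, (lo - (j : Site 2)) i + ((shellD P + 1 + P.d + KCmax + Rs : ℕ) : ℤ) ≤ (hi + (j : Site 2)) i) (hDρ : Rs + 1 ≤ shellD P)
    (hRg : ∀ c, ∀ u ∈ Rg c, u ∈ graphBall G c Rs) (hRgcard : ∀ c, (Rg c).card ≤ cU) (hcU1 : 1 ≤ cU)
    (hrs : 1 + (P.N * (tanOff P.ℓs P.M + 2) + P.N * P.d + (KCmax + Rs)) ≤ rs)
    (hcS : (P.N + 1) * (tanOff P.ℓs P.M + 1) + (P.N + 1) * P.d + (KCmax + 1) + cU ≤ cS)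
    -- the zone datum at the kit centres
    {Λc : V → ℕ → Finset V} {kz : ℕ} (hΛRg : ∀ c, Λc c kz ⊆ Rg c) (hzconn : ∀ c, ∀ s ∈ Λc c kz, PathIn G (↑(Λc c kz) : Set V) c s)
    (hcz : ∀ c, c ∈ Λc c kz)
    (hcol : ∀ x ∈ outerBoundary (winGraph G w₀ R) (winLevel G ψ w₀ R lo hi j), IsNear G ψ (lo - (j : Site 2)) (hi + (j : Site 2)) P w₀ R x →
      ctColEnd G SF P w₀ R x ∈ Λc (ctCtr G SF P w₀ R x) kz)
    -- the habitat, the level's source/support, the weighting, the region (containing the habitat level) and the target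
    {Ω : Finset V} (hfull : winLevel G ψ w₀ R lo hi j ⊆ Ω) (k : ℕ) (o : V) (Sfin : Finset V) {Wt : Sym2 V → unitInterval} {D T : Finset V}
    (hXD : winLevelIn ψ Ω lo hi j ⊆ D) {N : ℕ} (hN : k * (Δ + 1) ^ (2 * rs) ≤ N)
    (hk : (1 - (q : ℝ) ^ (1 + Δ * cS + cS * cU)) ^ k ≤ δ)
    -- per contact: PADDED — the inner `Ω`-neighbour in the target; FAR — the inner neighbour in the target; NEAR — a zone-box vertex in the target,
    -- or the route datum at accuracy `δ³`
    (hpad : ∀ x ∈ outerBoundary (winGraphIn G Ω) (winLevelIn ψ Ω lo hi j), x ∉ outerBoundary (winGraph G w₀ R) (winLevel G ψ w₀ R lo hi j) →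
      inNbrIn G ψ Ω (Finset.Icc (lo - (j : Site 2)) (hi + (j : Site 2))) x ∈ T)
    (hfar : ∀ x ∈ outerBoundary (winGraph G w₀ R) (winLevel G ψ w₀ R lo hi j), ¬ IsNear G ψ (lo - (j : Site 2)) (hi + (j : Site 2)) P w₀ R x →
      ctY G ψ w₀ R (lo - (j : Site 2)) (hi + (j : Site 2)) x ∈ T)
    (hnear : ∀ x ∈ outerBoundary (winGraph G w₀ R) (winLevel G ψ w₀ R lo hi j), IsNear G ψ (lo - (j : Site 2)) (hi + (j : Site 2)) P w₀ R x →
      (∃ u ∈ Λc (ctCtr G SF P w₀ R x) kz, u ∈ T) ∨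
      ∃ Qt Ft : Finset V, Ft ⊆ T ∧ Qt ⊆ D ∧
        1 - δ ^ 3 ≤ (prodBernoulli Wt).real (linkIn (↑Qt : Set V) (Λc (ctCtr G SF P w₀ R x) kz) Ft)) :
    ∃ (σ : SData V) (S : Finset V), SHyp (winLDataIn G ψ Ω lo hi o Sfin) j σ ∧ σ.N ≤ N ∧
      (1 - (q : ℝ) ^ σ.sB) ^ σ.k ≤ δ ∧ S ⊆ D ∧ (∀ x ∈ σ.K, σ.face x ⊆ S) ∧
      RelayClause (winLDataIn G ψ Ω lo hi o Sfin) Wt j σ S T D δ := by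
  set K := outerBoundary (winGraph G w₀ R) (winLevel G ψ w₀ R lo hi j) with hKdef
  set KΩ := outerBoundary (winGraphIn G Ω) (winLevelIn ψ Ω lo hi j) with hKΩdef
  set κ := forcedGeom G SF P w₀ R Λc kz with hκ
  set κh := habPad G ψ Ω w₀ R lo hi j κ with hκh
  set S' := pinSetFHab G SF P Ω w₀ R Λc kz with hS'
  have hOK : KitOK G ψ w₀ R lo hi j rs cS cU κ :=
    kitOK_forced SF Rg hlip hq hstep hwide hdw hKC hA hθA hr₀ hR hT hDw hDρ hRg hRgcard hcU1 hrs hcS hΛRg hzconn hcol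
  have hrs1 : 1 ≤ rs := by omega
  have hcS1 : 1 ≤ cS := by omega
  have hOKh : KitOKHab G ψ Ω lo hi j rs cS cU κh := kitOKHab_pad hOK hfull hrs1 hcS1 hcU1
  have hface : ∀ x ∈ KΩ, κh.U x ⊆ S' := fun x hx => face_subset_pinSetFHab hx
  have hSX : S' ⊆ winLevelIn ψ Ω lo hi j := Finset.biUnion_subset.2 fun x hx => hOKh.U_sub x hx
  have hSD : S' ⊆ D := hSX.trans hXD
  have hσ : SHyp (winLDataIn G ψ Ω lo hi o Sfin) j (kitSDataHab G ψ hΔ Ω lo hi j κh rs cS cU k) := shyp_kitHab hlip hOKh o Sfin k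
  refine ⟨kitSDataHab G ψ hΔ Ω lo hi j κh rs cS cU k, S', hσ, hN, hk, hSD, fun x hx => ?_, ?_⟩
  · rw [kitSDataHab_K] at hx; rw [kitSDataHab_face]; exact hface x hx
  refine relayClause_of_forced hσ (by rw [winLDataIn_X]; exact hSX) hSD
    (fun x hx => by rw [kitSDataHab_K] at hx; rw [kitSDataHab_face]; exact hface x hx) hδ fun x hx => ?_
  rw [kitSDataHab_K] at hx
  rw [kitSDataHab_face, kitSDataHab_seed]
  by_cases hp : x ∈ K
  · -- a plain contact: the padded kit IS the forced kit there
    have hyeq : κh.y x = κ.y x := (habPad_of_mem hp).1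
    have hSeq : κh.S x = κ.S x := (habPad_of_mem hp).2.1
    have hUeq : κh.U x = κ.U x := (habPad_of_mem hp).2.2
    by_cases hnx : IsNear G ψ (lo - (j : Site 2)) (hi + (j : Site 2)) P w₀ R x
    · have hUx : κ.U x = Λc (ctCtr G SF P w₀ R x) kz := forcedGeom_U_of_near hnx
      rcases hnear x hp hnx with ⟨u, hu, huT⟩ | ⟨Qt, Ft, hFtT, hQtD, h3⟩
      · exact Or.inl ⟨u, by rw [hUeq, hUx]; exact hu, huT⟩
      refine Or.inr ⟨⟨ctCtr G SF P w₀ R x, by rw [hUeq, hUx]; exact hcz _⟩, fun ω hω u hu v hv => ?_, Qt, Ft, hFtT, hQtD,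
        by rw [hUeq, hUx]; exact h3⟩
      -- `hbox`: the `G`-edges inside the face are seed edges inside the shell, hence open; the face is connected through its centre
      rw [hUeq, hUx] at hu hv
      rw [kitSeed_congr hyeq hSeq hUeq] at hω
      set c := ctCtr G SF P w₀ R x with hc
      have hZW : Λc c kz ⊆ winLevelIn ψ Ω lo hi j := by have h := hOKh.U_sub x hx; rw [hUeq, hUx] at h; exact h
      have hZD : (↑(Λc c kz) : Set V) ⊆ ↑D := Finset.coe_subset.2 (hZW.trans hXD)
      have hopen : ∀ a b, a ∈ (↑(Λc c kz) : Set V) → b ∈ (↑(Λc c kz) : Set V) → G.Adj a b → s(a, b) ∈ ω := by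
        intro a b ha hb hab
        have haS : a ∈ κ.S x := forcedGeom_U_subset_S x (by rw [hUx]; exact Finset.mem_coe.1 ha)
        have hbS : b ∈ κ.S x := forcedGeom_U_subset_S x (by rw [hUx]; exact Finset.mem_coe.1 hb)
        refine hω _ (edgesIn_subset_kitSeed κ x ((mem_edgesIn_iff).2 ⟨(SimpleGraph.mem_edgeSet (G := G)).2 hab, fun z hz => ?_⟩)) ?_
        · rcases Sym2.mem_iff.1 hz with rfl | rfl
          · exact haS
          · exact hbS
        · refine mk_mem_wireSet_iff.2 ⟨?_, ?_, hab.ne⟩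
          · exact Finset.mem_coe.2 (hface x hx (by rw [hUeq, hUx]; exact Finset.mem_coe.1 ha))
          · exact Finset.mem_coe.2 (hface x hx (by rw [hUeq, hUx]; exact Finset.mem_coe.1 hb))
      have hpu : PathIn (openGraph ω) (↑D : Set V) c u := pathIn_openGraph_of_open hZD hopen (hzconn c u hu)
      have hpv : PathIn (openGraph ω) (↑D : Set V) c v := pathIn_openGraph_of_open hZD hopen (hzconn c v hv)
      exact DCT16.mem_openConnIn_iff_pathIn.2 (hpu.symm.trans hpv)
    · have hUx : κ.U x = {ctY G ψ w₀ R (lo - (j : Site 2)) (hi + (j : Site 2)) x} := forcedGeom_U_of_far hnx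
      exact Or.inl ⟨_, by rw [hUeq, hUx]; exact Finset.mem_singleton_self _, hfar x hp hnx⟩
  · -- a padded contact: the one-vertex kit at the inner `Ω`-neighbour, which lies in the target
    have hUx : κh.U x = {inNbrIn G ψ Ω (Finset.Icc (lo - (j : Site 2)) (hi + (j : Site 2))) x} := (habPad_of_not_mem hp).2.2
    exact Or.inl ⟨_, by rw [hUx]; exact Finset.mem_singleton_self _, hpad x hx hp⟩

end Skelφ

end Summit.CriticalPhenomena.PercolationContinuityZ3.Theorems.Transplant

end
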